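import Summits.QuantumFields.BalabanUV.T4Continuum.Spine.NE3.FrameNormalisationOneLevel
import HarnessLib

/-!
# T⁴ programme, node NE3 — census R50: THE `k`-LEVEL FRAME NORMALISATION OF [Balaban1985Averaging] (96)–(99) — under a HIERARCHICALLY block-covariantly-constant
# moving-frame gauge `v` the double-bar averages transform by moving frames and the accumulated frame CONJUGATES, `v_k(U′^{v}) = R(v_{(k)})·v_k(U′)`; the gauge
# `u := v·u₀` with top corner values `v(L^k z) = v_k(U₀′)(z)` satisfies the frame condition `v_k(U′) = u_k`, hence (1.37) at a level-`k` pair (`FrameNormalisation`)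

Cell `pub-balaban-gaps` (track G2, seat ne3, generation 11), row NE3; census `HOME/ne/NE3.md` §4 R50, §17.  This is the `k`-level version of `FrameNormalisationOneLevel`:
the CONSTRUCTION of a gauge meeting `PairFrameCondition`'s frame condition `vcov L W U′ k = uLev L u k` (and therefore the (1.37) clause `dbavgCovIter L W U′ k = 1` of
`PairLandauGaugeB8Avg` at a pair with common `k`-fold average), for every order `k`, from ANY pre-gauge `u₀` trivial at the top block corners.  The mechanism is
[Balaban1985Averaging] pp. 31–32: the accumulated frame `v_k` (97) is a product of block frames of the successive double-bar averages at the backgrounds `Ū₀ʲ`, and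
(98)∕(99) transport moving frames through the recursion (91).

* HIERARCHICAL BLOCK-COVARIANT CONSTANCY (a hypothesis, written inline): for every `j < k`, the level-`j` corner values `v_j = uLev L v j` are block-covariantly
  constant on the `L`-blocks of `Ω^{(j)}` relative to the averaged background `Ū₀ʲ = avgIter L W j`:
  `R(Ū₀ʲ(Γ_{Ly,Ly+r})) v_j(Ly + r) = v_j(Ly)`.
* §1 `dbavgCovIter_mgauge_of_hier` ∕ `vcov_mgauge_of_hier` — for such `v`: `(U′^{v})̿ʲ = (U̿′ʲ)^{v_j}` (moving frame relative to `Ū₀ʲ`, [Balaban1985Averaging] (71)∕(98)) and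
  `v_j(U′^{v})(z) = v_j(z)·v_j(U′)(z)·v_j(z)⁻¹` for all `j ≤ k`, by induction over `FrameNormalisationOneLevel.dbavgCov_mgauge_of_blockCovConst` and
  `wframe_mgauge_of_blockCovConst` (the recursion (91) runs through `dbavgCov` at the background `Ū₀ʲ`).
* §2 `exists_hier_extension` — every top corner datum `c : Ω^{(k)} → G` extends to a hierarchically block-covariantly-constant `v` with `v(L^k z) = c(z)`
  (downward recursion on the levels through `exists_blockCovConst_extension'`).
* §5 `rep_dbar_of_frameNormalised` — the same in `LandauRepB8Avg`'s literal vocabulary: `rep : U_A^{u} = vary W Z 1` and `dbar` for `Z := Ad_{W⁻¹}(log U′)` when `‖U′ − 1‖ < 1`.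
* §3∕§4 **`frameCondition`**, **`dbavgCovIter_eq_one_of_pair`**, **`exists_frameNormalised`** (and the primed versions for an ARBITRARY pre-gauge `u₀`, top datum
  `v(L^kz) := u₀(L^kz)⁻¹·v_k(U₀′)(z)` — the form that re-normalises a Landau step's output) — with `u₀(L^k z) = 1`, `U_A^{u₀} = U₀′·W`, and `v` the hierarchical extension of
  `z ↦ v_k(U₀′)(z)`: `u := v·u₀`, `U′ := U₀′^{v}` satisfy `U_A^{u} = U′·W`, **`vcov L W U′ k = uLev L u k`**, and at a pair (`Ū_Aᵏ = V = W̄ᵏ`) **`dbavgCovIter L W U′ k = 1`** —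
  [Balaban1985RegularSpaces] (1.37) with `B = 0`, i.e. the restriction (1.29) realised by a piecewise covariantly-constant gauge: the frame condition is SOLVABLE AT EVERY ORDER, explicitly,
  with no smallness hypothesis (but see «WHAT THIS IS NOT» for why this realisation is only the zeroth-order one).

WHAT THIS IS NOT (honest, located).  This is the ZEROTH-ORDER realisation of the frame condition: it identifies the corner data (`u_k = v_k(U′)`, top datum
`u₀(L^kz)⁻¹·v_k(U₀′)(z)`) and the covariance mechanism, and it gives (1.37) EXACTLY — but a piecewise covariantly-constant gauge JUMPS across block faces by the corner oscillation of
`v_k(U₀′)`, which is of order `d·L^k·sup‖log U₀′‖` ([Balaban1985Averaging] (163), tree `B7Eq162General.eq163_general`), i.e. (0)-size against the (−1)-size sup member (1.36) of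
`LandauRepB8`: the normalised perturbation `U₀′^{v}` is `(−1)`-small on the tree bonds of every block but NOT on block-face bonds.  The (1.36)-compatible realisation interpolates the
SAME corner data smoothly inside the blocks (gradient `ω∕L^k`, the tree's `NE7CornerGaugeInterpolation.exists_smooth_corner_gauge`), loses exact covariance, and restores the frame
condition by a fixed point — which is the joint problem with the (1.38)-Landau step of the owner lineage's brick E′ ([Balaban1985RegularSpaces] Sect. E (1.100)); census R50's remaining
half.  The size letter `‖v_k(U₀′) − 1‖ ≤ 64d·L^k·b` is `B7Eq162General.eq163_general` (not plugged here); nor is the END-framed direction `Z = log(W⁻¹U′W)`-dictionary (`relPert W Z = U′`) restated (it is `PairLandauB8Avg.relPert_mul_eq_vary` plus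
`exp ∘ log` on the `‖U′ − 1‖ < 1` ball).  Nothing of Bałaban's is asserted: group algebra on the tree's formal objects.  **NE3 NOT proved**; spine PROVED 0∕9; finite T⁴ rung (B)+1
— NOT continuum YM on ℝ⁴, NOT infinite volume, NOT mass gap, NOT `BetaPertH`, NOT Clay.  HONEST DEPENDENCY: continuum YM on T⁴ ⇐ BetaPertH ∧ nine spine estimates (0/9
proved); BetaPertH ⇐ (D1) ∧ (D4) ∧ CAP+tail; G-an2-4 gates asym, D1 and NE2/3/4.  PLACEMENT: `Summits/QuantumFields/BalabanUV/T4Continuum/Spine/NE3/`; imports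
`FrameNormalisationOneLevel` only.

References: [Balaban1985Averaging] T. Bałaban, *Averaging operations for lattice gauge theories*, CMP 98 (1985) 17–51: (71) p. 29, (91)–(92) p. 31, (96)–(99) p. 32;
[Balaban1985RegularSpaces] CMP 99 (1985), (1.29) p. 80, (1.37) p. 82.
-/

set_option autoImplicit false

open scoped BigOperators Matrix Matrix.Norms.L2Operator
open NormedSpace

namespace Summit.QuantumFields.BalabanUV.T4Continuum.NE3.FrameNormalisation

open Literature.MathematicalPhysics.QuantumFieldTheory.Balaban1983to89
open B7Prop1Explicit B7Prop2Explicit MatrixLog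
open B7AvgGaugeCovariance (uLev uLev_apply uLev_zero uLev_smul uLev_smul_add)
open B7Eq92Concrete (Rc Rc_apply mgauge mgauge_apply mgauge_mul tHol Fcov wframe dbavgCov dbavgCov_apply
  dbavgCovIter dbavgCovIter_zero dbavgCovIter_succ vcov vcov_zero vcov_succ)
open B8Eq115GaugeFixing (gaugeAct_mul)
open T4AveragingDeficitWall (Ad vary)
open NE3.PairLandauB8Avg (relPert relPert_mul_eq_vary)
open NE3.FrameNormalisationOneLevel (wframe_mgauge_of_blockCovConst dbavgCov_mgauge_of_blockCovConst site_eq_corner_add_boxVec corner_boxVec_unique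
  dbavgCovIter_eq_one_of_frame_eq')

noncomputable section

variable {d : ℕ} {n : Type*} [Fintype n] [DecidableEq n]

/-! ## §1 Covariance of the `j`-fold double-bar average and of the accumulated frame under hierarchically block-covariantly-constant gauges -/

/-- **THE `j`-FOLD DOUBLE-BAR AVERAGE AND THE ACCUMULATED FRAME UNDER A HIERARCHICALLY BLOCK-COVARIANTLY-CONSTANT GAUGE** ([Balaban1985Averaging] (71)∕(98)): if for every
`i < j` the level-`i` corner values `v_i` are block-covariantly constant relative to `Ū₀ⁱ = avgIter L W i`, then `(U′^{v})̿ʲ = (U̿′ʲ)^{v_j}` (moving frame relative to `Ū₀ʲ`) and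
`v_j(U′^{v})(z) = v_j(z)·v_j(U′)(z)·v_j(z)⁻¹`. [folklore] -/
theorem dbavgCovIter_vcov_mgauge_of_hier (L : ℕ) (W U' : Site d → Fin d → (Matrix n n ℂ)ˣ) (v : Site d → (Matrix n n ℂ)ˣ) :
    ∀ j : ℕ, (∀ i < j, ∀ (y : Site d) (r : Fin d → Fin L),
        Rc (hol (avgIter L W i) ((L : ℤ) • y) (treeWord (boxVec L r))) (uLev L v i ((L : ℤ) • y + boxVec L r)) = uLev L v i ((L : ℤ) • y)) →
      dbavgCovIter L W (mgauge W v U') j = mgauge (avgIter L W j) (uLev L v j) (dbavgCovIter L W U' j) ∧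
        ∀ z : Site d, vcov L W (mgauge W v U') j z = Rc (uLev L v j z) (vcov L W U' j z)
  | 0, _ => by
    refine ⟨?_, fun z => ?_⟩
    · rw [dbavgCovIter_zero, dbavgCovIter_zero, avgIter_zero, uLev_zero]
    · rw [vcov_zero, vcov_zero, map_one]
  | j + 1, h => by
    obtain ⟨hd, hv⟩ := dbavgCovIter_vcov_mgauge_of_hier L W U' v j (fun i hi => h i (Nat.lt_succ_of_lt hi))
    have hj := h j (Nat.lt_succ_self j)
    refine ⟨?_, fun z => ?_⟩
    · funext z κ
      have hj' : ∀ r : Fin d → Fin L, Rc (hol (avgIter L W j) ((L : ℤ) • z + (L : ℤ) • e κ) (treeWord (boxVec L r)))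
          (uLev L v j ((L : ℤ) • z + (L : ℤ) • e κ + boxVec L r)) = uLev L v j ((L : ℤ) • z + (L : ℤ) • e κ) := by
        intro r
        rw [← smul_add]
        exact hj (z + e κ) r
      rw [dbavgCovIter_succ, hd, mgauge_apply, dbavgCovIter_succ,
        dbavgCov_mgauge_of_blockCovConst L (avgIter L W j) (dbavgCovIter L W U' j) (uLev L v j) ((L : ℤ) • z) κ (hj z) hj',
        avgIter_succ, rescale_apply, uLev_smul, ← smul_add, uLev_smul]
    · rw [vcov_succ, vcov_succ, hv, hd, wframe_mgauge_of_blockCovConst L (avgIter L W j) (dbavgCovIter L W U' j) (uLev L v j) _ (hj z),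
        uLev_smul, Rc_apply, Rc_apply, Rc_apply]
      group

/-! ## §2 Hierarchical block-covariantly-constant extension of top corner data -/

/-- One-level extension with corner data indexed by the block label: `∃ ṽ`, `ṽ(Lz) = c z` and `ṽ` block-covariantly constant relative to `V₀`
(`ṽ(Lz + r) = V₀(Γ_{Lz,Lz+r})⁻¹·c(z)·V₀(Γ_{Lz,Lz+r})`). [folklore] -/
theorem exists_blockCovConst_extension' {L : ℕ} (hL : 1 ≤ L) (V₀ : Site d → Fin d → (Matrix n n ℂ)ˣ) (c : Site d → (Matrix n n ℂ)ˣ) :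
    ∃ w : Site d → (Matrix n n ℂ)ˣ, (∀ z : Site d, w ((L : ℤ) • z) = c z) ∧
      ∀ (z : Site d) (r : Fin d → Fin L), Rc (hol V₀ ((L : ℤ) • z) (treeWord (boxVec L r))) (w ((L : ℤ) • z + boxVec L r)) = w ((L : ℤ) • z) := by
  classical
  have hdec := fun x : Site d => site_eq_corner_add_boxVec (d := d) hL x
  choose zOf rOf hzr using hdec
  have hzc : ∀ (z : Site d) (r : Fin d → Fin L), zOf ((L : ℤ) • z + boxVec L r) = z ∧ rOf ((L : ℤ) • z + boxVec L r) = r := by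
    intro z r
    have hu := corner_boxVec_unique (d := d) hL (hzr ((L : ℤ) • z + boxVec L r)).symm
    exact ⟨hu.1, hu.2⟩
  have hb : boxVec L (fun _ : Fin d => (⟨0, hL⟩ : Fin L)) = 0 := by funext i; simp [boxVec]
  have hz0 : ∀ z : Site d, zOf ((L : ℤ) • z) = z ∧ rOf ((L : ℤ) • z) = fun _ => ⟨0, hL⟩ := by
    intro z
    have h := hzc z (fun _ => ⟨0, hL⟩)
    rw [hb, add_zero] at h
    exact h
  refine ⟨fun x => (hol V₀ ((L : ℤ) • zOf x) (treeWord (boxVec L (rOf x))))⁻¹ * c (zOf x) *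
      hol V₀ ((L : ℤ) • zOf x) (treeWord (boxVec L (rOf x))), fun z => ?_, fun z r => ?_⟩
  · simp only [(hz0 z).1, (hz0 z).2, hb, treeWord_zero, hol_nil, inv_one, one_mul, mul_one]
  · simp only [(hzc z r).1, (hzc z r).2, (hz0 z).1, (hz0 z).2, hb, treeWord_zero, hol_nil, inv_one, one_mul, mul_one, Rc_apply]
    group

/-- **EVERY TOP CORNER DATUM EXTENDS HIERARCHICALLY**: for `c : Ω^{(k)} → G` there is `v` with `v(L^k z) = c(z)` whose level-`j` corner values are block-covariantly constant
relative to `Ū₀ʲ` for every `j < k` (downward recursion: the level-`(k−1)` corner values are the one-level extension of `c` relative to `Ū₀^{k−1}`, and so on). [folklore] -/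
theorem exists_hier_extension {L : ℕ} (hL : 1 ≤ L) (W : Site d → Fin d → (Matrix n n ℂ)ˣ) :
    ∀ (k : ℕ) (c : Site d → (Matrix n n ℂ)ˣ), ∃ v : Site d → (Matrix n n ℂ)ˣ,
      (∀ z : Site d, v (((L : ℤ) ^ k) • z) = c z) ∧
      ∀ i < k, ∀ (y : Site d) (r : Fin d → Fin L),
        Rc (hol (avgIter L W i) ((L : ℤ) • y) (treeWord (boxVec L r))) (uLev L v i ((L : ℤ) • y + boxVec L r)) = uLev L v i ((L : ℤ) • y)
  | 0, c => ⟨c, fun z => by rw [pow_zero, one_smul], fun i hi => absurd hi (Nat.not_lt_zero i)⟩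
  | k + 1, c => by
    -- the level-`k` corner values: the one-level extension of `c` relative to `Ū₀ᵏ`
    obtain ⟨w, hwc, hw⟩ := exists_blockCovConst_extension' hL (avgIter L W k) c
    obtain ⟨v, hvc, hv⟩ := exists_hier_extension hL W k w
    refine ⟨v, fun z => ?_, fun i hi y r => ?_⟩
    · rw [pow_succ, mul_smul, hvc, hwc]
    · rcases Nat.lt_succ_iff_lt_or_eq.mp hi with hi' | rfl
      · exact hv i hi' y r
      · -- level `i = k`: `v_k = w` on `Ω^{(k)}`
        have hk : ∀ x : Site d, uLev L v i x = w x := fun x => by rw [uLev_apply, hvc]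
        rw [hk, hk]
        exact hw y r

/-! ## §3 The frame normalisation at every order -/

/-- **THE FRAME CONDITION AT ORDER `k`.**  `u₀` trivial at the top corners (`u₀(L^k z) = 1`) with `U_A^{u₀} = U₀′·W`; `v` hierarchically block-covariantly constant with top
values `v(L^k z) = v_k(U₀′)(z)`; `u := v·u₀`, `U′ := U₀′^{v}`.  Then `U_A^{u} = U′·W` and **`vcov L W U′ k = uLev L u k`**. [folklore] -/
theorem frameCondition (L k : ℕ) {u₀ v : Site d → (Matrix n n ℂ)ˣ} {UA W U₀' : Site d → Fin d → (Matrix n n ℂ)ˣ}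
    (hrep₀ : gaugeAct u₀ UA = U₀' * W) (hu₀ : ∀ z : Site d, u₀ (((L : ℤ) ^ k) • z) = 1)
    (htop : ∀ z : Site d, v (((L : ℤ) ^ k) • z) = vcov L W U₀' k z)
    (hhier : ∀ i < k, ∀ (y : Site d) (r : Fin d → Fin L),
      Rc (hol (avgIter L W i) ((L : ℤ) • y) (treeWord (boxVec L r))) (uLev L v i ((L : ℤ) • y + boxVec L r)) = uLev L v i ((L : ℤ) • y)) :
    gaugeAct (v * u₀) UA = mgauge W v U₀' * W ∧ vcov L W (mgauge W v U₀') k = uLev L (v * u₀) k := by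
  refine ⟨by rw [gaugeAct_mul, hrep₀, mgauge_mul], ?_⟩
  funext z
  rw [(dbavgCovIter_vcov_mgauge_of_hier L W U₀' v k hhier).2 z, uLev_apply, htop z, Rc_apply, mul_inv_cancel_right]
  simp only [uLev_apply, Pi.mul_apply, hu₀ z, mul_one]
  exact (htop z).symm

/-- **(1.37) AT A LEVEL-`k` PAIR FOR THE FRAME-NORMALISED GAUGE**: with the data of `frameCondition` at a pair with `Ū_Aᵏ = V = W̄ᵏ`, `dbavgCovIter L W (U₀′^{v}) k = 1`. [folklore] -/
theorem dbavgCovIter_eq_one_of_pair (L k : ℕ) {u₀ v : Site d → (Matrix n n ℂ)ˣ} {UA W U₀' V : Site d → Fin d → (Matrix n n ℂ)ˣ}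
    (hrep₀ : gaugeAct u₀ UA = U₀' * W) (hu₀ : ∀ z : Site d, u₀ (((L : ℤ) ^ k) • z) = 1)
    (htop : ∀ z : Site d, v (((L : ℤ) ^ k) • z) = vcov L W U₀' k z)
    (hhier : ∀ i < k, ∀ (y : Site d) (r : Fin d → Fin L),
      Rc (hol (avgIter L W i) ((L : ℤ) • y) (treeWord (boxVec L r))) (uLev L v i ((L : ℤ) • y + boxVec L r)) = uLev L v i ((L : ℤ) • y))
    (hA : avgIter L UA k = V) (hW : avgIter L W k = V) :
    dbavgCovIter L W (mgauge W v U₀') k = 1 := by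
  obtain ⟨hrep, hframe⟩ := frameCondition L k hrep₀ hu₀ htop hhier
  exact dbavgCovIter_eq_one_of_frame_eq' L k hrep hA hW hframe

/-- **THE FRAME NORMALISATION EXISTS AT EVERY ORDER** (`L ≥ 1`): at a pair with common `k`-fold average `V`, for every pre-gauge `u₀` trivial at the top block corners with
`U_A^{u₀} = U₀′·W` there are a gauge `u` and a start-frame perturbation `U′` with `U_A^{u} = U′·W`, the frame condition `vcov L W U′ k = uLev L u k`, and (1.37)
`dbavgCovIter L W U′ k = 1`; moreover `u = v·u₀`, `U′ = U₀′^{v}` with `v` hierarchically block-covariantly constant and `v(L^k z) = v_k(U₀′)(z)`. [folklore] -/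
theorem exists_frameNormalised {L : ℕ} (hL : 1 ≤ L) (k : ℕ) {u₀ : Site d → (Matrix n n ℂ)ˣ} {UA W U₀' V : Site d → Fin d → (Matrix n n ℂ)ˣ}
    (hrep₀ : gaugeAct u₀ UA = U₀' * W) (hu₀ : ∀ z : Site d, u₀ (((L : ℤ) ^ k) • z) = 1) (hA : avgIter L UA k = V) (hW : avgIter L W k = V) :
    ∃ (v : Site d → (Matrix n n ℂ)ˣ),
      (∀ z : Site d, v (((L : ℤ) ^ k) • z) = vcov L W U₀' k z) ∧
      (∀ i < k, ∀ (y : Site d) (r : Fin d → Fin L),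
        Rc (hol (avgIter L W i) ((L : ℤ) • y) (treeWord (boxVec L r))) (uLev L v i ((L : ℤ) • y + boxVec L r)) = uLev L v i ((L : ℤ) • y)) ∧
      gaugeAct (v * u₀) UA = mgauge W v U₀' * W ∧ vcov L W (mgauge W v U₀') k = uLev L (v * u₀) k ∧ dbavgCovIter L W (mgauge W v U₀') k = 1 := by
  obtain ⟨v, htop, hhier⟩ := exists_hier_extension hL W k (vcov L W U₀' k)
  obtain ⟨hrep, hframe⟩ := frameCondition L k hrep₀ hu₀ htop hhier
  exact ⟨v, htop, hhier, hrep, hframe, dbavgCovIter_eq_one_of_frame_eq' L k hrep hA hW hframe⟩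

/-! ## §4 General pre-gauge: the top datum `v(L^k z) := u₀(L^k z)⁻¹ · v_k(U₀′)(z)` -/

/-- **THE FRAME CONDITION FROM AN ARBITRARY PRE-GAUGE** (no corner-triviality): with `U_A^{u₀} = U₀′·W`, `v` hierarchically block-covariantly constant and
`v(L^k z) = u₀(L^k z)⁻¹·v_k(U₀′)(z)`, the gauge `u := v·u₀` and `U′ := U₀′^{v}` satisfy `U_A^{u} = U′·W` and `vcov L W U′ k = uLev L u k`
(`v_k(U′) = v_k·v_k(U₀′)·v_k⁻¹ = v_k·(u₀)_k` iff `v_k = (u₀)_k⁻¹·v_k(U₀′)`) — the form in which a Landau step's output gauge (not corner-trivial) is re-normalised. [folklore] -/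
theorem frameCondition' (L k : ℕ) {u₀ v : Site d → (Matrix n n ℂ)ˣ} {UA W U₀' : Site d → Fin d → (Matrix n n ℂ)ˣ}
    (hrep₀ : gaugeAct u₀ UA = U₀' * W)
    (htop : ∀ z : Site d, v (((L : ℤ) ^ k) • z) = (u₀ (((L : ℤ) ^ k) • z))⁻¹ * vcov L W U₀' k z)
    (hhier : ∀ i < k, ∀ (y : Site d) (r : Fin d → Fin L),
      Rc (hol (avgIter L W i) ((L : ℤ) • y) (treeWord (boxVec L r))) (uLev L v i ((L : ℤ) • y + boxVec L r)) = uLev L v i ((L : ℤ) • y)) :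
    gaugeAct (v * u₀) UA = mgauge W v U₀' * W ∧ vcov L W (mgauge W v U₀') k = uLev L (v * u₀) k := by
  refine ⟨by rw [gaugeAct_mul, hrep₀, mgauge_mul], ?_⟩
  funext z
  rw [(dbavgCovIter_vcov_mgauge_of_hier L W U₀' v k hhier).2 z, uLev_apply, Rc_apply]
  simp only [uLev_apply, Pi.mul_apply]
  have h := htop z
  -- `v_k · v_k(U₀′) · v_k⁻¹ = v_k · u₀_k` since `v_k(U₀′) = u₀_k · v_k`
  have h2 : vcov L W U₀' k z = u₀ (((L : ℤ) ^ k) • z) * v (((L : ℤ) ^ k) • z) := by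
    rw [h, mul_inv_cancel_left]
  rw [h2]
  group

/-- **THE FRAME NORMALISATION FROM AN ARBITRARY PRE-GAUGE, EVERY ORDER** (`L ≥ 1`): at a pair with common `k`-fold average, for every `u₀` with `U_A^{u₀} = U₀′·W` there is a
hierarchically block-covariantly-constant `v` (top datum `u₀(L^kz)⁻¹·v_k(U₀′)(z)`) such that `u := v·u₀`, `U′ := U₀′^{v}` satisfy `U_A^{u} = U′·W`, `vcov L W U′ k = uLev L u k` and
(1.37) `dbavgCovIter L W U′ k = 1`. [folklore] -/
theorem exists_frameNormalised' {L : ℕ} (hL : 1 ≤ L) (k : ℕ) {u₀ : Site d → (Matrix n n ℂ)ˣ} {UA W U₀' V : Site d → Fin d → (Matrix n n ℂ)ˣ}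
    (hrep₀ : gaugeAct u₀ UA = U₀' * W) (hA : avgIter L UA k = V) (hW : avgIter L W k = V) :
    ∃ (v : Site d → (Matrix n n ℂ)ˣ),
      (∀ z : Site d, v (((L : ℤ) ^ k) • z) = (u₀ (((L : ℤ) ^ k) • z))⁻¹ * vcov L W U₀' k z) ∧
      (∀ i < k, ∀ (y : Site d) (r : Fin d → Fin L),
        Rc (hol (avgIter L W i) ((L : ℤ) • y) (treeWord (boxVec L r))) (uLev L v i ((L : ℤ) • y + boxVec L r)) = uLev L v i ((L : ℤ) • y)) ∧
      gaugeAct (v * u₀) UA = mgauge W v U₀' * W ∧ vcov L W (mgauge W v U₀') k = uLev L (v * u₀) k ∧ dbavgCovIter L W (mgauge W v U₀') k = 1 := by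
  obtain ⟨v, htop, hhier⟩ := exists_hier_extension hL W k (fun z => (u₀ (((L : ℤ) ^ k) • z))⁻¹ * vcov L W U₀' k z)
  obtain ⟨hrep, hframe⟩ := frameCondition' L k hrep₀ htop hhier
  exact ⟨v, htop, hhier, hrep, hframe, dbavgCovIter_eq_one_of_frame_eq' L k hrep hA hW hframe⟩

/-! ## §5 Dictionary to the END-framed direction: `relPert W Z = U′` for `Z := Ad_{W⁻¹}(log U′)` -/

/-- **THE END-FRAMED DIRECTION OF A START-FRAME PERTURBATION**: for `‖U′(b) − 1‖ < 1`, `Z(b) := Ad_{W(b)⁻¹}(log U′(b))` has `relPert W Z = U′` ([Balaban1985Averaging] (21) «it is an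
inverse to the exponential function», `MatrixLog.exp_mlog`), hence `vary W Z 1 = U′·W` (`PairLandauB8Avg.relPert_mul_eq_vary`). [folklore] -/
theorem relPert_Ad_inv_mlog {W U' : Site d → Fin d → (Matrix n n ℂ)ˣ} (hU : ∀ (x : Site d) (μ : Fin d), ‖((U' x μ : (Matrix n n ℂ)ˣ) : Matrix n n ℂ) - 1‖ < 1) :
    relPert W (fun x μ => Ad (W x μ)⁻¹ (mlog ((U' x μ : (Matrix n n ℂ)ˣ) : Matrix n n ℂ))) = U' := by
  funext x μ
  apply Units.ext
  unfold relPert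
  -- `Ad_u(Ad_{u⁻¹}X) = X` (the tree's `CurvedLandauGaugeLetters.Ad_Ad_inv'`, inlined to keep the imports minimal)
  have hAd : ∀ (u : (Matrix n n ℂ)ˣ) (X : Matrix n n ℂ), Ad u (Ad u⁻¹ X) = X := fun u X => by
    simp only [Ad, inv_inv]
    rw [show (u : Matrix n n ℂ) * (((u⁻¹ : (Matrix n n ℂ)ˣ) : Matrix n n ℂ) * X * (u : Matrix n n ℂ)) * ((u⁻¹ : (Matrix n n ℂ)ˣ) : Matrix n n ℂ)
        = ((u : Matrix n n ℂ) * ((u⁻¹ : (Matrix n n ℂ)ˣ) : Matrix n n ℂ)) * X * ((u : Matrix n n ℂ) * ((u⁻¹ : (Matrix n n ℂ)ˣ) : Matrix n n ℂ)) by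
        noncomm_ring, Units.mul_inv, one_mul, mul_one]
  rw [val_expUnit, hAd, exp_mlog (hU x μ)]

/-- **(1.37) IN THE LITERAL VOCABULARY OF `LandauRepB8Avg` FOR THE FRAME-NORMALISED GAUGE**: with the data of `frameCondition'` at a pair with common `k`-fold average, if the normalised
perturbation `U′ = U₀′^{v}` is within `1` of the identity bondwise, then `u := v·u₀` and `Z := Ad_{W⁻¹}(log U′)` satisfy `rep : U_A^{u} = vary W Z 1` and `dbar : dbavgCovIter L W (relPert W Z) k = 1`
— the two fields of `PairLandauB8Avg.LandauRepB8Avg` that concern the average (the regularity members are untouched here). [folklore] -/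
theorem rep_dbar_of_frameNormalised (L k : ℕ) {u₀ v : Site d → (Matrix n n ℂ)ˣ} {UA W U₀' V : Site d → Fin d → (Matrix n n ℂ)ˣ}
    (hrep₀ : gaugeAct u₀ UA = U₀' * W)
    (htop : ∀ z : Site d, v (((L : ℤ) ^ k) • z) = (u₀ (((L : ℤ) ^ k) • z))⁻¹ * vcov L W U₀' k z)
    (hhier : ∀ i < k, ∀ (y : Site d) (r : Fin d → Fin L),
      Rc (hol (avgIter L W i) ((L : ℤ) • y) (treeWord (boxVec L r))) (uLev L v i ((L : ℤ) • y + boxVec L r)) = uLev L v i ((L : ℤ) • y))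
    (hA : avgIter L UA k = V) (hW : avgIter L W k = V)
    (hsmall : ∀ (x : Site d) (μ : Fin d), ‖((mgauge W v U₀' x μ : (Matrix n n ℂ)ˣ) : Matrix n n ℂ) - 1‖ < 1) :
    gaugeAct (v * u₀) UA = vary W (fun x μ => Ad (W x μ)⁻¹ (mlog ((mgauge W v U₀' x μ : (Matrix n n ℂ)ˣ) : Matrix n n ℂ))) 1 ∧
      dbavgCovIter L W (relPert W (fun x μ => Ad (W x μ)⁻¹ (mlog ((mgauge W v U₀' x μ : (Matrix n n ℂ)ˣ) : Matrix n n ℂ)))) k = 1 := by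
  obtain ⟨hrep, hframe⟩ := frameCondition' L k hrep₀ htop hhier
  have hZ := relPert_Ad_inv_mlog (W := W) hsmall
  refine ⟨?_, ?_⟩
  · rw [← relPert_mul_eq_vary, hZ]; exact hrep
  · rw [hZ]; exact dbavgCovIter_eq_one_of_frame_eq' L k hrep hA hW hframe

end

end Summit.QuantumFields.BalabanUV.T4Continuum.NE3.FrameNormalisation
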